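import Literature.NumberTheory.EllipticCurves.ZpExtensionEisensteinPiTorsionCutH2InputsProofs
import Literature.NumberTheory.EllipticCurves.ZpExtensionEisensteinPiLevelH2CountOfBasisProofs
import HarnessLib

/-!
# (hH2Fil) and (hH2) at `w ∣ p` for EVERY level, from an adapted basis
# (theorems only — no definition, no named fact, no instance, no `sorry`)

Topic `NumberTheory/EllipticCurves` (sequel of `ZpExtensionEisensteinPiTorsionCutH2InputsProofs`: `piTorsionCut_hH2Fil` for
`i ≥ 1` under adapted-basis / scalar binders, `piTorsionCut_hH2_of_natCard_le` from a level count; and of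
`ZpExtensionEisensteinPiLevelH2CountOfBasisProofs`: the binder discharge and the all-level count).  Last glue brick of (F4) on the
uniform-`ι` road of cell `pub/bsd-print-x9` (stub `stub_h5bAtS`): the two `H²`-ANNIHILATION hypotheses of the torsion-cut readout
(`piTorsionCut_hF2`'s `hH2Fil : ∀ j z, H²(t j) z = 0` and `piTorsionCut_hLift`'s `hH2 : ∀ j z, H²(π^{c'}•) z = 0`) in their
`∀ j` form, with NO basis or scalar binder left — only the adapted coordinates `hbasis` of the ordinary datum, `κ(g₀) = p^s` and
`p^s < m`:

* `WeierstrassCurve.piFil_zero_eq_zero` — the plus part of the level `0` is zero;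
* `WeierstrassCurve.piTorsionCut_hH2Fil_of_basis` — **`H²(t) = 0` on `H²(K_w, Fil_w(T/π^iT))` for every `i` and every
  endomorphism `t` of the plus part acting as `π^{p^s}`** (`i = 0`: the plus part is zero; `i ≥ 1`: `piTorsionCut_hH2Fil` with
  the adapted pair, `λ` from the stability of `Fil_w`, `c` from `exists_int_forall_mu_apply_eq_smul`);
* `WeierstrassCurve.piTorsionCut_hH2_of_basis` — **`H²(π^{2p^s}•) = 0` on `H²(K_w, T/π^jT)` for every `j`**
  (`piTorsionCut_hH2_of_natCard_le` fed with `natCard_two_piLevel_le_of_basis`).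

No summit statement is proved; BSD is not proved by any of this.

References: [Howard2004HeegnerKolyvagin] §1.3 H.5(b), Lemma 3.2.7 (arXiv:1202.6340 p. 16 L150–156), §2.2 and proof of
Thm. 2.2.10, §3.1; [MilneADT2006] I Cor. 2.3; [GreenbergLNM1716] §2 and proof of Prop. 4.15.
-/

set_option autoImplicit false

noncomputable section

open Function NumberField IsDedekindDomain Field
open scoped NumberField ContRepresentation

namespace WeierstrassCurve

open Literature.NumberTheory.EllipticCurves Literature.NumberTheory.GaloisRepresentations
open Literature.NumberTheory.GaloisRepresentations.DiscreteGaloisModule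
open Literature.NumberTheory.EllipticCurves.ZpExtension (EisensteinLevel OrdinaryFiltration)
open Literature.NumberTheory.GaloisCohomology.Howard2004

variable {K : Type} [Field K] [NumberField K] (E : WeierstrassCurve K) [E.IsElliptic] {p : ℕ} [hp : Fact p.Prime]
  (κ : Literature.NumberTheory.EllipticCurves.ZpExtension K p) {m : ℕ} (hm : 1 ≤ m) (w : HeightOneSpectrum (𝓞 K))
  (Φ : OrdinaryFiltration (fun j ↦ E.torsionGaloisModule ((p : ℤ) ^ j)) (fun j ↦ E.torsionGaloisModuleReduce p j) w)

/-- **The plus part of the level `0` is zero** (the level `0` itself is zero).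
[cite: Howard2004HeegnerKolyvagin, §2.2 and §3.1 (arXiv:1202.6340 p. 11, p. 15 L56–62)] -/
theorem piFil_zero_eq_zero (x : E.piFil κ hm Φ 0) : x = 0 :=
  Subtype.ext (E.piLevel_zero_eq_zero κ hm _)

set_option maxHeartbeats 800000 in
-- the statement re-elaborates the subrepresentation binders of `piTorsionCut_hH2Fil` (same budget as there)
/-- **(hH2Fil) at `w` for every level, from an adapted basis**: for every `i` and every endomorphism `t` of the plus-part
subrepresentation `Fil_w(T/π^iT)` acting as `π^{p^s}`, `H²(t) = 0` on `H²(K_w, Fil_w(T/π^iT))` — the `∀ j` letter `hH2Fil` of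
`piTorsionCut_hF2` (`c := p^s`).  For `i = 0` the plus part is zero; for `i ≥ 1` this is `piTorsionCut_hH2Fil` with the adapted
pair of `hbasis`, the scalar of `g₀` on the generator (stability of `Fil_w`) and the integer of `g₀` on `μ_{p^k}`.
[cite: Howard2004HeegnerKolyvagin, Lemma 3.2.7 (arXiv:1202.6340 p. 16 L150–156), §2.2 and proof of Thm. 2.2.10]
[cite: MilneADT2006, Ch. I Cor. 2.3] [cite: GreenbergLNM1716, §2 and proof of Prop. 4.15] -/
theorem piTorsionCut_hH2Fil_of_basis
    (hbasis : ∀ k, 1 ≤ k → ∃ e : E.geomTorsion ((p : ℤ) ^ k) ≃+ (Fin 2 → ZMod (p ^ k)), ∀ x, x ∈ Φ.fil k ↔ e x 1 = 0)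
    {g₀ : absoluteGaloisGroup (w.adicCompletion K)} {s : ℕ}
    (hg₀ : (κ (absGaloisRestrict K (w.adicCompletion K) g₀)).toAdd = ((p ^ s : ℕ) : ℤ_[p])) (hms : p ^ s < m) (i : ℕ)
    (t : ((GaloisRep.toLocal w ((E.eisensteinPiRefinementDatum κ hm).levelRep i)).subrepresentation
        (E.piFil κ hm Φ i) (E.piFil_le_comap κ hm Φ i)).toContRepresentation →ⁱL
      ((GaloisRep.toLocal w ((E.eisensteinPiRefinementDatum κ hm).levelRep i)).subrepresentation
        (E.piFil κ hm Φ i) (E.piFil_le_comap κ hm Φ i)).toContRepresentation)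
    (ht : ∀ x : E.piFil κ hm Φ i, ((t x : E.piFil κ hm Φ i) : (E.eisensteinPiRefinementDatum κ hm).Level i) =
      (E.eisensteinPiRefinementDatum κ hm).π ^ (p ^ s) • (x : (E.eisensteinPiRefinementDatum κ hm).Level i))
    (z : galoisCohomology ((GaloisRep.toLocal w ((E.eisensteinPiRefinementDatum κ hm).levelRep i)).subrepresentation
        (E.piFil κ hm Φ i) (E.piFil_le_comap κ hm Φ i)) 2) :
    galoisCohomology.map t 2 z = 0 := by
  classical
  rcases Nat.eq_zero_or_pos i with rfl | hi
  · haveI : Subsingleton (E.piFil κ hm Φ 0) :=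
      ⟨fun a b ↦ by rw [E.piFil_zero_eq_zero κ hm w Φ a, E.piFil_zero_eq_zero κ hm w Φ b]⟩
    haveI hsub : Subsingleton (galoisCohomology ((GaloisRep.toLocal w
        ((E.eisensteinPiRefinementDatum κ hm).levelRep 0)).subrepresentation (E.piFil κ hm Φ 0) (E.piFil_le_comap κ hm Φ 0)) 2) :=
      subsingleton_continuousCohomology_of_subsingleton ((GaloisRep.toLocal w
        ((E.eisensteinPiRefinementDatum κ hm).levelRep 0)).subrepresentation (E.piFil κ hm Φ 0) (E.piFil_le_comap κ hm Φ 0)).toTopRep 1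
    exact Subsingleton.elim _ _
  · haveI : CharZero (w.adicCompletion K) := charZero_of_injective_algebraMap (algebraMap K _).injective
    have hhost : 1 ≤ (E.eisensteinPiRefinementDatum κ hm).host i := by
      rw [WeierstrassCurve.eisensteinPiRefinementDatum_host]
      exact Nat.div_pos (by omega) hm
    haveI : NeZero (p ^ (E.eisensteinPiRefinementDatum κ hm).host i) := ⟨pow_ne_zero _ hp.out.ne_zero⟩
    obtain ⟨e, he⟩ := hbasis _ hhost
    obtain ⟨P₀, Q₀, hP₀, hgen, -⟩ := exists_adapted_pair_of_addEquiv (Φ.fil ((E.eisensteinPiRefinementDatum κ hm).host i)) e he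
    obtain ⟨lam₁, hlam₁⟩ := hgen _ (Φ.smul_mem _ g₀ P₀ hP₀)
    obtain ⟨c, hc, hcp⟩ := exists_int_forall_mu_apply_eq_smul (p := p) (w.adicCompletion K)
      ((E.eisensteinPiRefinementDatum κ hm).host i) g₀
    exact E.piTorsionCut_hH2Fil κ hm w Φ hi P₀ hP₀ hgen hg₀ hms lam₁ hlam₁.symm c hc hcp t ht z

/-- **(hH2) at `w` for every level, from an adapted basis**: `H²(π^{2p^s}•) = 0` on `H²(K_w, T/π^jT)` for every `j` — the
`∀ j` letter `hH2` of `piTorsionCut_hLift` with `c' := 2p^s` (`piTorsionCut_hH2_of_natCard_le` fed with the all-level count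
`natCard_two_piLevel_le_of_basis`). [cite: Howard2004HeegnerKolyvagin, Lemma 3.2.7 (arXiv:1202.6340 p. 16 L150–156), §2.2 and proof of Thm. 2.2.10]
[cite: MilneADT2006, Ch. I Cor. 2.3] [cite: GreenbergLNM1716, §2 and proof of Prop. 4.15] -/
theorem piTorsionCut_hH2_of_basis
    (hbasis : ∀ k, 1 ≤ k → ∃ e : E.geomTorsion ((p : ℤ) ^ k) ≃+ (Fin 2 → ZMod (p ^ k)), ∀ x, x ∈ Φ.fil k ↔ e x 1 = 0)
    {g₀ : absoluteGaloisGroup (w.adicCompletion K)} {s : ℕ}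
    (hg₀ : (κ (absGaloisRestrict K (w.adicCompletion K) g₀)).toAdd = ((p ^ s : ℕ) : ℤ_[p])) (hms : p ^ s < m) (j : ℕ)
    (z : galoisCohomology (GaloisRep.toLocal w ((E.eisensteinPiRefinementDatum κ hm).levelRep j)) 2) :
    galoisCohomology.scalarMap (GaloisRep.toLocal w ((E.eisensteinPiRefinementDatum κ hm).levelRep j))
      (((E.eisensteinPiRefinementDatum κ hm).isScalarLinear_levelRep j).restrictField _) 2
      ((E.eisensteinPiRefinementDatum κ hm).π ^ (2 * p ^ s)) z = 0 :=
  E.piTorsionCut_hH2_of_natCard_le κ hm w (fun j ↦ (E.natCard_two_piLevel_le_of_basis κ hm Φ hbasis hg₀ hms j).1)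
    (fun j ↦ (E.natCard_two_piLevel_le_of_basis κ hm Φ hbasis hg₀ hms j).2) j z

/-- **The plus-part endomorphisms `t_j = π^{p^s}•|_{Fil}` with `H²(t_j) = 0`, for every level, from an adapted basis** — the
binders `t`, `ht`, `hH2Fil` of `piTorsionCut_hF2` (`c := p^s`) PACKAGED: the scalar endomorphism `π^{p^s}•` of each plus-part
subrepresentation (`exists_subScalarPowFamily_apply`) together with `piTorsionCut_hH2Fil_of_basis`.
[cite: Howard2004HeegnerKolyvagin, Lemma 3.2.7 (arXiv:1202.6340 p. 16 L150–156), §2.2 and proof of Thm. 2.2.10]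
[cite: MilneADT2006, Ch. I Cor. 2.3] [cite: GreenbergLNM1716, §2 and proof of Prop. 4.15] -/
theorem exists_piTorsionCut_subEndo_of_basis
    (hbasis : ∀ k, 1 ≤ k → ∃ e : E.geomTorsion ((p : ℤ) ^ k) ≃+ (Fin 2 → ZMod (p ^ k)), ∀ x, x ∈ Φ.fil k ↔ e x 1 = 0)
    {g₀ : absoluteGaloisGroup (w.adicCompletion K)} {s : ℕ}
    (hg₀ : (κ (absGaloisRestrict K (w.adicCompletion K) g₀)).toAdd = ((p ^ s : ℕ) : ℤ_[p])) (hms : p ^ s < m) :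
    ∃ t : ∀ j, ((GaloisRep.toLocal w ((E.eisensteinPiRefinementDatum κ hm).levelRep j)).subrepresentation
        (E.piFil κ hm Φ j) (E.piFil_le_comap κ hm Φ j)).toContRepresentation →ⁱL
      ((GaloisRep.toLocal w ((E.eisensteinPiRefinementDatum κ hm).levelRep j)).subrepresentation
        (E.piFil κ hm Φ j) (E.piFil_le_comap κ hm Φ j)).toContRepresentation,
      (∀ j (x : E.piFil κ hm Φ j), ((t j x : E.piFil κ hm Φ j) : (E.eisensteinPiRefinementDatum κ hm).Level j) =
        (E.eisensteinPiRefinementDatum κ hm).π ^ (p ^ s) • (x : (E.eisensteinPiRefinementDatum κ hm).Level j)) ∧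
      ∀ j (z : galoisCohomology ((GaloisRep.toLocal w ((E.eisensteinPiRefinementDatum κ hm).levelRep j)).subrepresentation
        (E.piFil κ hm Φ j) (E.piFil_le_comap κ hm Φ j)) 2), galoisCohomology.map (t j) 2 z = 0 := by
  have hT := fun j ↦ exists_subScalarPowFamily_apply
    (ρ := GaloisRep.toLocal w ((E.eisensteinPiRefinementDatum κ hm).levelRep j))
    (((E.eisensteinPiRefinementDatum κ hm).isScalarLinear_levelRep j).restrictField _) (E.piFil κ hm Φ j)
    (E.piFil_le_comap κ hm Φ j) (fun r x hx ↦ E.smul_mem_piFil κ hm w Φ j r x hx) (E.eisensteinPiRefinementDatum κ hm).π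
  choose T hT using hT
  exact ⟨fun j ↦ T j (p ^ s), fun j x ↦ hT j (p ^ s) x,
    fun j z ↦ E.piTorsionCut_hH2Fil_of_basis κ hm w Φ hbasis hg₀ hms j (T j (p ^ s)) (fun x ↦ hT j (p ^ s) x) z⟩

end WeierstrassCurve

end
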